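import Literature.NumberTheory.EllipticCurves.RealLatticeRealLocusProofs
import Literature.NumberTheory.EllipticCurves.ModularCurveRealPeriodProofs
import HarnessLib

/-!
# Crux C1 `MainConjectureTransportAlignedAtTwo` (stmt-BirchSwinnertonDyer-22296), line `birth`, input (M1) of the `Δ > 0` half (R1):
# THE ORDERING OF `℘` AT THE HALF-PERIODS OF A REAL RECTANGULAR LATTICE — `℘(iΩ₀'/2)` is the SMALLEST and `℘(Ω₀/2)` the LARGEST
# real root of `4x³ − g₂x − g₃` (lead seat att-p1 g10; `--supports 22296`)

THEOREMS ONLY (no `def`, no `sorry`, no named fact). BSD is not proved by this; C1 is not closed by this.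

Why the line needs it (`Cruxes/MainConjectureTransportAlignedAtTwo/DELTA-POS-REAL-LOCUS-att-p1-g10.md` §3/§7, REF2-PLACEMENT-v40-add3 flag F2).
On the `Δ(W₁) > 0` residual the mod-`2` plus functional of the depleted newform is `e₂(T*, ·)` for the `2`-torsion point `T* = u(ω₂/2)`
(`ω₂` the purely imaginary generator of the rectangular Néron lattice, `u` the uniformisation), while the crux's `AlignedAtInfinity` names the
`2`-torsion point with the SMALLEST abscissa. This file is the dictionary between the two (input (M1) = typing ask (T3)), proved from the
tree's real-lattice analysis (`RealLatticePeriodProofs`, `RealLatticePeriodDiscrProofs`, `RealLatticeRealLocusProofs`):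

* §1 (any real lattice, no sign condition) `le_weierstrassPRe_half_of_cubic_eq_zero`: every real root of `f = 4x³ − g₂x − g₃` is `≤ e₁ = ℘(Ω₀/2)`
  (`f > 0` on `(e₁, ∞)`); `cubic_halfPeriodI_eq_zero`, `halfPeriodI_le_of_cubic_eq_zero`: `e' := ℘(iΩ₀'/2) = −℘_{iΛ}(Ω₀'/2)` is a real root and
  every real root is `≥ e'` (`f < 0` on `(−∞, e')`); `weierstrassP_halfPeriodI` (the complex value `℘(w)`, `w = iΩ₀'/2`, is the real number `e'`).
* §2 (rectangular, `disc f = g₂³ − 27g₃² > 0`) `halfPeriodI_lt_half_of_discr_pos`: `e' < e₁`; `cubic_eq_zero_iff_of_discr_pos`: the complex roots of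
  `f` are exactly `e'`, `e₁` and the middle root `−e₁ − e'`; `weierstrassP_halfPeriod_re_mem` / `halfPeriodI_le_weierstrassP_re_of_two_mul_mem`: for EVERY
  half-period `z` (`z ∉ Λ`, `2z ∈ Λ`) the value `℘(z)` is real with `e' ≤ re ℘(z) ≤ e₁`.
* §3 (curves) `ModularParametrizationData.halfPeriodI_le_of_Δ_pos`: for `W/ℚ` with `0 < Δ` and a parametrisation datum `D` (Néron lattice `D.L`,
  uniformisation `u = D.uniformize`, `u z = (℘(z) − b₂/12, …)` by `uniformize_spec`), the half-period `w = iΩ₀'/2` of `D.L` satisfies `2w ∈ Λ_E`,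
  `w ∉ Λ_E`, and `re ℘(w) ≤ re ℘(z)` for every half-period `z`: `u w` is the `2`-torsion point of least abscissa — the point `T*` of the line.

References: Lawden, *Elliptic Functions and Applications* (1989) §6.11–§6.12 (`e₁ > e₂ > e₃`, `e₃ = ℘(ω₂/2)` on `OY`); Lang, *Elliptic Functions*
Ch. 1 §2; Whittaker–Watson §20.32; Cremona 1997 §3.7; Silverman ATAEC V.2.
-/

noncomputable section

-- justification: the `Summit.BirchSwinnertonDyer.BirchSwinnertonDyer.…` path repeats a component (route-file convention)
set_option linter.dupNamespace false
set_option autoImplicit false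

open scoped ComplexConjugate
open Complex Set PeriodPair

namespace Summit.BirchSwinnertonDyer.BirchSwinnertonDyer.Theorems.AlignedTransportAtTwoHalfPeriodOrdering

/-! ## §1 Largest and smallest real roots (any real lattice) -/

section AnyRealLattice

variable {L : PeriodPair}

/-- **`e₁ = ℘(Ω₀/2)` is the LARGEST real root**: every real root of `4x³ − g₂x − g₃` is `≤ ℘(Ω₀/2)`, because the cubic is positive on
`(℘(Ω₀/2), ∞)` (`IsReal.cubic_pos_of_lt`). [cite: Lawden1989, §6.11] -/
theorem le_weierstrassPRe_half_of_cubic_eq_zero (h : L.IsReal) {x : ℝ}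
    (hx : 4 * x ^ 3 - L.g₂.re * x - L.g₃.re = 0) : x ≤ L.weierstrassPRe (L.minRealPeriod / 2) := by
  by_contra hlt
  have := h.cubic_pos_of_lt (not_le.mp hlt)
  linarith

/-- **`e' = −℘_{iΛ}(Ω₀'/2)` is a real root** of `4x³ − g₂x − g₃` (the root lemma for the rotated real lattice `iΛ`, whose invariants are
`g₂, −g₃`). [cite: Lawden1989, §6.10 (6.10.14), §6.11] -/
theorem cubic_halfPeriodI_eq_zero (h : L.IsReal) :
    4 * (-(L.mulLeft I I_ne_zero).weierstrassPRe ((L.mulLeft I I_ne_zero).minRealPeriod / 2)) ^ 3 -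
      L.g₂.re * (-(L.mulLeft I I_ne_zero).weierstrassPRe ((L.mulLeft I I_ne_zero).minRealPeriod / 2)) - L.g₃.re = 0 := by
  have h0 := h.mulLeft_I.cubic_weierstrassPRe_half
  rw [g₂_mulLeft_I, g₃_mulLeft_I, Complex.neg_re] at h0
  linear_combination -h0

/-- **`e'` is the SMALLEST real root**: every real root of `4x³ − g₂x − g₃` is `≥ e' = −℘_{iΛ}(Ω₀'/2)`, because the cubic is negative on
`(−∞, e')` (`IsReal.cubic_neg_of_lt`). [cite: Lawden1989, §6.11 (p. 170, on `OY`)] -/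
theorem halfPeriodI_le_of_cubic_eq_zero (h : L.IsReal) {x : ℝ}
    (hx : 4 * x ^ 3 - L.g₂.re * x - L.g₃.re = 0) :
    -(L.mulLeft I I_ne_zero).weierstrassPRe ((L.mulLeft I I_ne_zero).minRealPeriod / 2) ≤ x := by
  by_contra hlt
  have := h.cubic_neg_of_lt (not_le.mp hlt)
  linarith

/-- **The value of `℘` at the imaginary half-period** `w = iΩ₀'/2`: `℘_Λ(w) = −℘_{iΛ}(Ω₀'/2) = e'` (a real number).
[cite: Lawden1989, §6.10 (6.10.14)] -/
theorem weierstrassP_halfPeriodI (h : L.IsReal) :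
    ℘[L] (I * (((L.mulLeft I I_ne_zero).minRealPeriod / 2 : ℝ) : ℂ)) =
      ((-(L.mulLeft I I_ne_zero).weierstrassPRe ((L.mulLeft I I_ne_zero).minRealPeriod / 2) : ℝ) : ℂ) := by
  rw [weierstrassP_I_mul, Complex.ofReal_neg, h.mulLeft_I.ofReal_weierstrassPRe]

/-- The value of `℘` at the real half-period `Ω₀/2` is the real number `e₁ = weierstrassPRe (Ω₀/2)`. [folklore] -/
theorem weierstrassP_half (h : L.IsReal) :
    ℘[L] (((L.minRealPeriod / 2 : ℝ) : ℂ)) = ((L.weierstrassPRe (L.minRealPeriod / 2) : ℝ) : ℂ) :=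
  (h.ofReal_weierstrassPRe _).symm

/-- `e' ≤ e₁` for every real lattice. [folklore] -/
theorem halfPeriodI_le_half (h : L.IsReal) :
    -(L.mulLeft I I_ne_zero).weierstrassPRe ((L.mulLeft I I_ne_zero).minRealPeriod / 2) ≤ L.weierstrassPRe (L.minRealPeriod / 2) :=
  halfPeriodI_le_of_cubic_eq_zero h h.cubic_weierstrassPRe_half

end AnyRealLattice

/-! ## §2 Rectangular lattices (`disc > 0`): strict ordering, the three roots, every half-period value in between -/

section Rectangular

variable {L : PeriodPair}

/-- **Strict ordering `e' < e₁` when `g₂³ − 27g₃² > 0`.** If `e' = e₁ =: e` then `e` would be the only real root; but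
`disc = (g₂ − 3e²)(12e² − g₂)² > 0` gives `g₂ − 3e² > 0`, so `r = (−e + √(g₂ − 3e²))/2` is a real root of the cofactor `4x² + 4ex + 4e² − g₂`, hence of
the cubic, and `r = e` would force `12e² = g₂`, `disc = 0`. [cite: Lawden1989, §6.11–§6.12] -/
theorem halfPeriodI_lt_half_of_discr_pos (h : L.IsReal) (hdisc : 0 < L.g₂.re ^ 3 - 27 * L.g₃.re ^ 2) :
    -(L.mulLeft I I_ne_zero).weierstrassPRe ((L.mulLeft I I_ne_zero).minRealPeriod / 2) < L.weierstrassPRe (L.minRealPeriod / 2) := by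
  set e := L.weierstrassPRe (L.minRealPeriod / 2) with he_def
  set e' := -(L.mulLeft I I_ne_zero).weierstrassPRe ((L.mulLeft I I_ne_zero).minRealPeriod / 2) with he'_def
  set A := L.g₂.re with hA
  set B := L.g₃.re with hB
  have he : 4 * e ^ 3 - A * e - B = 0 := h.cubic_weierstrassPRe_half
  refine lt_of_le_of_ne (halfPeriodI_le_half h) fun hee ↦ ?_
  -- `disc = (A − 3e²)(12e² − A)²`
  have hd : A ^ 3 - 27 * B ^ 2 = (A - 3 * e ^ 2) * (12 * e ^ 2 - A) ^ 2 := cubic_discr_eq_of_root he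
  have h12 : 12 * e ^ 2 - A ≠ 0 := by
    intro h0; rw [hd, h0] at hdisc; simp at hdisc
  have h3 : 0 < A - 3 * e ^ 2 := by
    by_contra hle
    have : (A - 3 * e ^ 2) * (12 * e ^ 2 - A) ^ 2 ≤ 0 := mul_nonpos_of_nonpos_of_nonneg (not_lt.mp hle) (sq_nonneg _)
    linarith
  -- the root `r = (−e + s)/2`, `s = √(A − 3e²)`
  set s := Real.sqrt (A - 3 * e ^ 2) with hs
  have hs2 : s ^ 2 = A - 3 * e ^ 2 := Real.sq_sqrt h3.le
  have hs0 : 0 < s := Real.sqrt_pos.mpr h3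
  have hr : 4 * ((-e + s) / 2) ^ 3 - A * ((-e + s) / 2) - B = 0 := by
    linear_combination he + ((s - 3 * e) / 2) * hs2
  -- `e' ≤ r ≤ e` and `e' = e` force `r = e`
  have hr1 : (-e + s) / 2 ≤ e := le_weierstrassPRe_half_of_cubic_eq_zero h hr
  have hr2 : e' ≤ (-e + s) / 2 := halfPeriodI_le_of_cubic_eq_zero h hr
  rw [hee] at hr2
  have hre : s = 3 * e := by linarith
  have h9 : s ^ 2 = 9 * e ^ 2 := by rw [hre]; ring
  apply h12
  linarith [hs2, h9]

/-- **The complex roots of the cubic are real and lie in `[e', e₁]`** (rectangular case): if `4u³ − g₂u − g₃ = 0` for `u ∈ ℂ` then `u` is real and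
`e' ≤ re u ≤ e₁`. Factorisation `f(u) = (u − e₁)((2u + e₁)² − s²)`, `s² = g₂ − 3e₁²`. [cite: Lawden1989, §6.12] -/
theorem im_eq_zero_and_mem_Icc_of_cubic_eq_zero (h : L.IsReal) (hdisc : 0 < L.g₂.re ^ 3 - 27 * L.g₃.re ^ 2) {u : ℂ}
    (hu : 4 * u ^ 3 - L.g₂ * u - L.g₃ = 0) :
    u.im = 0 ∧ -(L.mulLeft I I_ne_zero).weierstrassPRe ((L.mulLeft I I_ne_zero).minRealPeriod / 2) ≤ u.re ∧
      u.re ≤ L.weierstrassPRe (L.minRealPeriod / 2) := by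
  set e := L.weierstrassPRe (L.minRealPeriod / 2) with he_def
  set A := L.g₂.re with hA
  set B := L.g₃.re with hB
  have he : 4 * e ^ 3 - A * e - B = 0 := h.cubic_weierstrassPRe_half
  have hd : A ^ 3 - 27 * B ^ 2 = (A - 3 * e ^ 2) * (12 * e ^ 2 - A) ^ 2 := cubic_discr_eq_of_root he
  have h3 : 0 < A - 3 * e ^ 2 := by
    by_contra hle
    have : (A - 3 * e ^ 2) * (12 * e ^ 2 - A) ^ 2 ≤ 0 := mul_nonpos_of_nonpos_of_nonneg (not_lt.mp hle) (sq_nonneg _)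
    linarith
  set s := Real.sqrt (A - 3 * e ^ 2) with hs
  have hs2 : s ^ 2 = A - 3 * e ^ 2 := Real.sq_sqrt h3.le
  -- the invariants are real
  have hg₂ : L.g₂ = (A : ℂ) := (h.ofReal_g₂_re).symm
  have hg₃ : L.g₃ = (B : ℂ) := (h.ofReal_g₃_re).symm
  -- complex factorisation
  have hfac : (u - e) * ((2 * u + e) - s) * ((2 * u + e) + s) = 0 := by
    have hs2' : (s : ℂ) ^ 2 = (A : ℂ) - 3 * (e : ℂ) ^ 2 := by exact_mod_cast hs2
    have he' : 4 * (e : ℂ) ^ 3 - (A : ℂ) * e - B = 0 := by exact_mod_cast he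
    rw [hg₂, hg₃] at hu
    linear_combination hu - he' - (u - e) * hs2'
  -- so `u ∈ {e, (−e ± s)/2}`, all real
  have hreal : ∃ x : ℝ, u = x ∧ 4 * x ^ 3 - A * x - B = 0 := by
    rcases mul_eq_zero.mp hfac with h12 | h3'
    · rcases mul_eq_zero.mp h12 with h1 | h2
      · exact ⟨e, by linear_combination h1, he⟩
      · refine ⟨(-e + s) / 2, ?_, ?_⟩
        · push_cast; linear_combination h2 / 2
        · linear_combination he + ((s - 3 * e) / 2) * hs2
    · refine ⟨(-e - s) / 2, ?_, ?_⟩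
      · push_cast; linear_combination h3' / 2
      · linear_combination he + ((-s - 3 * e) / 2) * hs2
  obtain ⟨x, rfl, hx⟩ := hreal
  exact ⟨Complex.ofReal_im x, by simpa using halfPeriodI_le_of_cubic_eq_zero h hx,
    by simpa using le_weierstrassPRe_half_of_cubic_eq_zero h hx⟩

/-- **Every half-period value lies between `e'` and `e₁`** (rectangular case): for `z ∉ Λ` with `2z ∈ Λ`, `℘(z)` is real and
`e' ≤ re ℘(z) ≤ e₁` — `℘'(z) = 0` (`derivWeierstrassP_eq_zero_of_two_mul_mem`) makes `℘(z)` a root of the cubic (`derivWeierstrassP_sq`).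
[cite: Lawden1989, §6.12] -/
theorem halfPeriod_value_real_and_mem_Icc (h : L.IsReal) (hdisc : 0 < L.g₂.re ^ 3 - 27 * L.g₃.re ^ 2) {z : ℂ}
    (hz : z ∉ L.lattice) (h2z : 2 * z ∈ L.lattice) :
    (℘[L] z).im = 0 ∧ -(L.mulLeft I I_ne_zero).weierstrassPRe ((L.mulLeft I I_ne_zero).minRealPeriod / 2) ≤ (℘[L] z).re ∧
      (℘[L] z).re ≤ L.weierstrassPRe (L.minRealPeriod / 2) := by
  refine im_eq_zero_and_mem_Icc_of_cubic_eq_zero h hdisc ?_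
  have h0 := L.derivWeierstrassP_sq z hz
  rw [derivWeierstrassP_eq_zero_of_two_mul_mem h2z] at h0
  linear_combination -h0

/-- **The imaginary half-period has the least `℘`-value among all half-periods** (rectangular case). With `w = iΩ₀'/2`: `2w ∈ Λ`, `w ∉ Λ`,
`conj w = −w`, `℘(w) = e'` is real, and `re ℘(w) ≤ re ℘(z)` for every half-period `z`; moreover `re ℘(w) < ℘(Ω₀/2)`.
[cite: Lawden1989, §6.11–§6.12] -/
theorem halfPeriodI_isLeast_of_discr_pos (h : L.IsReal) (hdisc : 0 < L.g₂.re ^ 3 - 27 * L.g₃.re ^ 2) :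
    2 * (I * (((L.mulLeft I I_ne_zero).minRealPeriod / 2 : ℝ) : ℂ)) ∈ L.lattice ∧
      I * (((L.mulLeft I I_ne_zero).minRealPeriod / 2 : ℝ) : ℂ) ∉ L.lattice ∧
      (℘[L] (I * (((L.mulLeft I I_ne_zero).minRealPeriod / 2 : ℝ) : ℂ))).im = 0 ∧
      (∀ z : ℂ, z ∉ L.lattice → 2 * z ∈ L.lattice →
        (℘[L] (I * (((L.mulLeft I I_ne_zero).minRealPeriod / 2 : ℝ) : ℂ))).re ≤ (℘[L] z).re) ∧
      (℘[L] (I * (((L.mulLeft I I_ne_zero).minRealPeriod / 2 : ℝ) : ℂ))).re < (℘[L] (((L.minRealPeriod / 2 : ℝ) : ℂ))).re := by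
  obtain ⟨h2w, hw, -⟩ := h.two_mul_halfPeriodI_mem
  refine ⟨h2w, hw, ?_, fun z hz h2z ↦ ?_, ?_⟩
  · rw [weierstrassP_halfPeriodI h, Complex.ofReal_im]
  · rw [weierstrassP_halfPeriodI h, Complex.ofReal_re]
    exact (halfPeriod_value_real_and_mem_Icc h hdisc hz h2z).2.1
  · rw [weierstrassP_halfPeriodI h, weierstrassP_half h, Complex.ofReal_re, Complex.ofReal_re]
    exact halfPeriodI_lt_half_of_discr_pos h hdisc

end Rectangular

/-! ## §3 Curves over `ℚ` with `Δ > 0`: the uniformised imaginary half-period is the `2`-torsion point of least abscissa -/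

section Curve

open Literature.NumberTheory.EllipticCurves.ModularForms

variable {W : WeierstrassCurve ℚ} {N : ℕ} [NeZero N] (D : ModularParametrizationData W N)

/-- **(M1) for a parametrisation datum.** For `W/ℚ` with `0 < Δ(W)` and `D : ModularParametrizationData W N` (Néron lattice `Λ_E = D.L.lattice`,
real with `disc = Δ(W) > 0`, i.e. rectangular), the imaginary half-period `w = iΩ₀'/2` of `Λ_E` satisfies `2w ∈ Λ_E`, `w ∉ Λ_E`, `℘(w)` is real, and
`re ℘(w) ≤ re ℘(z)` for EVERY half-period `z` of `Λ_E` (with `re ℘(w) < ℘(Ω₀/2)`). Since `D.uniformize z = (℘(z) − b₂/12, …)` off the lattice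
(`uniformize_spec`) and the non-zero `2`-torsion points of `E(ℂ)` are the `u(z)`, `2z ∈ Λ_E`, `z ∉ Λ_E`, this says: `D.uniformize w` is the
`2`-torsion point of LEAST abscissa — the point `T*` selected by `AlignedAtInfinity`. [cite: Lawden1989, §6.11–§6.12]
[cite: CremonaAlgorithms1997, §3.7] -/
theorem ModularParametrizationData.halfPeriodI_isLeast_of_Δ_pos (hΔ : 0 < W.Δ) :
    2 * (I * (((D.L.mulLeft I I_ne_zero).minRealPeriod / 2 : ℝ) : ℂ)) ∈ D.L.lattice ∧
      I * (((D.L.mulLeft I I_ne_zero).minRealPeriod / 2 : ℝ) : ℂ) ∉ D.L.lattice ∧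
      (℘[D.L] (I * (((D.L.mulLeft I I_ne_zero).minRealPeriod / 2 : ℝ) : ℂ))).im = 0 ∧
      (∀ z : ℂ, z ∉ D.L.lattice → 2 * z ∈ D.L.lattice →
        (℘[D.L] (I * (((D.L.mulLeft I I_ne_zero).minRealPeriod / 2 : ℝ) : ℂ))).re ≤ (℘[D.L] z).re) ∧
      (℘[D.L] (I * (((D.L.mulLeft I I_ne_zero).minRealPeriod / 2 : ℝ) : ℂ))).re <
        (℘[D.L] (((D.L.minRealPeriod / 2 : ℝ) : ℂ))).re := by
  refine halfPeriodI_isLeast_of_discr_pos D.isReal_neronLattice ?_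
  rw [D.discr_neronLattice]
  have : (W.baseChange ℝ).Δ = (W.Δ : ℝ) := by
    simp only [WeierstrassCurve.baseChange, WeierstrassCurve.map_Δ, eq_ratCast]
  rw [this]
  exact_mod_cast hΔ

end Curve

end Summit.BirchSwinnertonDyer.BirchSwinnertonDyer.Theorems.AlignedTransportAtTwoHalfPeriodOrdering

end
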